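import Summits.CriticalPhenomena.CardyFormulaZ2.Theorems.CardyComplexConeParafermionToSLESixFamiliesDiamondBIdGerm
import Mathlib.Analysis.SpecialFunctions.Pow.Deriv
import Mathlib.Analysis.SpecialFunctions.Pow.Continuity
import HarnessLib

/-!
# Line `potential-darboux-picard-diamond`, stub S4v (`stub_boundaryIdentification`): local exponents of a map of a half-disc onto a sector

Helper file of the stub `stub_boundaryIdentification` of crux `ParafermionToSLESixFamilies` (stmt-CriticalPhenomena-11389).
The boundedness of `H = (G′)³ψ/ψ′` near the corners and marks of the diamond (step (v) of the identification engine) is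
a statement about LOCAL EXPONENTS: a map `F` of the half-disc `B(0,r) ∩ {im ≥ 0}`, continuous, holomorphic inside, with
`F 0 = 0`, sending the diameter into the two boundary rays `ℝ≥0` and `ℝ≥0·e^{iγ}` of the sector `{0 < arg < γ}`
(`0 < γ < π`) and the open half-disc into the open sector, behaves like `ζ^{γ/π}`: the power `F^{π/γ}` is a map of the
half-disc into `ℍ`, real on the diameter (`sectorPow_props`), to which the germ bounds `germ_bounds` apply. This file
derives the three derivative estimates consumed by the local analysis, in rational form (no fractional powers in the
statements): `γ = π/2` (a corner of the diamond: `‖F′‖²‖ζ‖ ≍ 1`, `corner_deriv_bounds`, registered helper),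
`γ = π/3` (a marked corner of the hexagon: `‖F′‖³‖ζ‖² ≤ C`, `hex13_deriv_bound`) and `γ = 2π/3` (an unmarked corner or a
mark on a side of the hexagon: `‖F′‖³‖ζ‖ ≤ C`, `hex23_deriv_bound`).
-/

noncomputable section

namespace Summit.CriticalPhenomena.CardyFormulaZ2.Cruxes.ParafermionToSLESixFamilies.PotentialDarbouxPicardDiamond

open scoped Topology Real ComplexConjugate
open Filter Set Metric Complex

/-! ## Real powers of complex numbers: imaginary part and argument bookkeeping -/

/-- `im (z^e) = ‖z‖^e · sin (e · arg z)` for `z ≠ 0` and real `e`. -/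
theorem im_cpow_ofReal {z : ℂ} (hz : z ≠ 0) (e : ℝ) : (z ^ (e : ℂ)).im = ‖z‖ ^ e * Real.sin (e * arg z) := by
  rw [cpow_def_of_ne_zero hz, exp_im]
  have hre : (log z * e).re = Real.log ‖z‖ * e := by simp [log_re]
  have him : (log z * e).im = e * arg z := by simp [log_im]; ring
  rw [hre, him, Real.rpow_def_of_pos (norm_pos_iff.2 hz)]

/-- A point of positive argument below `π` has non-zero imaginary part (it lies in the open upper half-plane). -/
theorem im_pos_of_arg_mem {z : ℂ} (h1 : 0 < arg z) (h2 : arg z < π) : 0 < z.im := by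
  by_contra hle
  push Not at hle
  rcases hle.lt_or_eq with hlt | heq
  · exact absurd (Complex.arg_neg_iff.2 hlt) (not_lt.2 h1.le)
  · rcases le_or_gt 0 z.re with hre | hre
    · have := Complex.arg_eq_zero_iff.2 ⟨hre, heq⟩; linarith
    · have := Complex.arg_eq_pi_iff.2 ⟨hre, heq⟩; linarith

/-- The argument of `μ e^{iγ}` is `γ` for `μ > 0`, `γ ∈ (-π, π]`. -/
theorem arg_ofReal_mul_exp {μ γ : ℝ} (hμ : 0 < μ) (hγ : γ ∈ Set.Ioc (-π) π) :
    arg ((μ : ℂ) * exp (γ * I)) = γ := by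
  rw [exp_mul_I]; exact arg_mul_cos_add_sin_mul_I hμ hγ

/-! ## The power map of a sector -/

/-- **The power `F^{π/γ}` of a sector map is a half-plane map, real on the diameter.** For `e > 1`, `γ = π/e`, and
`F` continuous on `B(0,r) ∩ {im ≥ 0}`, holomorphic on `B(0,r) ∩ {im > 0}`, with `F 0 = 0`, diameter values on the
rays `ℝ≥0 ∪ ℝ≥0 e^{iγ}` and open-half-disc values in the open sector `{0 < arg < γ}`: the function `f = F^e` is
continuous on the closed half-disc, holomorphic inside, real on the diameter, `f 0 = 0`, `im f > 0` inside, and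
`f′ = e F^{e-1} F′` inside (where `F ≠ 0`). -/
theorem sectorPow_props (F : ℂ → ℂ) {r e : ℝ} (hr : 0 < r) (he : 1 < e)
    (hc : ContinuousOn F (ball (0:ℂ) r ∩ {z : ℂ | 0 ≤ z.im}))
    (hd : DifferentiableOn ℂ F (ball (0:ℂ) r ∩ {z : ℂ | 0 < z.im})) (h0 : F 0 = 0)
    (hdiam : ∀ z ∈ ball (0:ℂ) r, z.im = 0 → ∃ μ : ℝ, 0 ≤ μ ∧ (F z = μ ∨ F z = μ * exp ((π / e : ℝ) * I)))
    (hsect : ∀ z ∈ ball (0:ℂ) r, 0 < z.im → 0 < arg (F z) ∧ arg (F z) < π / e) :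
    ContinuousOn (fun ζ => F ζ ^ (e : ℂ)) (ball (0:ℂ) r ∩ {z : ℂ | 0 ≤ z.im}) ∧
    DifferentiableOn ℂ (fun ζ => F ζ ^ (e : ℂ)) (ball (0:ℂ) r ∩ {z : ℂ | 0 < z.im}) ∧
    (∀ z ∈ ball (0:ℂ) r, z.im = 0 → (F z ^ (e : ℂ)).im = 0) ∧ F 0 ^ (e : ℂ) = 0 ∧
    (∀ z ∈ ball (0:ℂ) r, 0 < z.im → 0 < (F z ^ (e : ℂ)).im) ∧
    (∀ z ∈ ball (0:ℂ) r, 0 < z.im → F z ≠ 0 ∧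
      HasDerivAt (fun ζ => F ζ ^ (e : ℂ)) (e * F z ^ ((e : ℂ) - 1) * deriv F z) z) := by
  have _ := hr
  have he0 : 0 < e := by linarith
  have hγ : 0 < π / e := div_pos Real.pi_pos he0
  have hγπ : π / e < π := by rw [div_lt_iff₀ he0]; nlinarith [Real.pi_pos]
  have hec : (e : ℂ) ≠ 0 := by exact_mod_cast he0.ne'
  have hopen : IsOpen (ball (0:ℂ) r ∩ {z : ℂ | 0 < z.im}) := isOpen_ball.inter (isOpen_lt continuous_const continuous_im)
  -- values in the open half-disc are non-zero with non-zero imaginary part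
  have hin : ∀ z ∈ ball (0:ℂ) r, 0 < z.im → F z ≠ 0 ∧ 0 < (F z).im := by
    intro z hz hzim
    obtain ⟨h1, h2⟩ := hsect z hz hzim
    have him : 0 < (F z).im := im_pos_of_arg_mem h1 (h2.trans hγπ)
    exact ⟨fun h => by rw [h] at him; simp at him, him⟩
  refine ⟨?_, ?_, ?_, by rw [h0, zero_cpow hec], ?_, ?_⟩
  · -- continuity on the closed half-disc
    intro z hz
    have hcond : 0 ≤ (F z).re ∨ (F z).im ≠ 0 := by
      rcases (show 0 ≤ z.im from hz.2).lt_or_eq with hpos | hzero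
      · exact Or.inr (hin z hz.1 hpos).2.ne'
      · obtain ⟨μ, hμ, hF | hF⟩ := hdiam z hz.1 hzero.symm
        · left; rw [hF]; simpa using hμ
        · rcases hμ.lt_or_eq with hμpos | hμ0
          · right; rw [hF, exp_mul_I]
            have hs : 0 < Real.sin (π / e) := Real.sin_pos_of_pos_of_lt_pi hγ hγπ
            simp only [mul_im, ofReal_re, ofReal_im, add_re, add_im, cos_ofReal_im, sin_ofReal_im, mul_re, I_re, I_im,
              sin_ofReal_re, cos_ofReal_re, mul_zero, mul_one, sub_zero, zero_mul, add_zero, zero_add]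
            positivity
          · left; rw [hF, ← hμ0]; simp
    exact (continuousAt_cpow_const_of_re_pos hcond (by simpa using he0)).comp_continuousWithinAt (hc z hz)
  · -- holomorphy inside
    intro z hz
    have hslit : F z ∈ slitPlane := mem_slitPlane_iff.2 (Or.inr (hin z hz.1 hz.2).2.ne')
    have hF : HasDerivAt F (deriv F z) z := (hd.differentiableAt (hopen.mem_nhds hz)).hasDerivAt
    exact (hF.cpow_const (c := (e : ℂ)) hslit).differentiableAt.differentiableWithinAt
  · -- real on the diameter
    intro z hz hzim
    obtain ⟨μ, hμ, hF | hF⟩ := hdiam z hz hzim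
    · rw [hF, ← ofReal_cpow hμ, ofReal_im]
    · rcases hμ.lt_or_eq with hμpos | hμ0
      · have hne : (μ : ℂ) * exp ((π / e : ℝ) * I) ≠ 0 := mul_ne_zero (by exact_mod_cast hμpos.ne') (exp_ne_zero _)
        rw [hF, im_cpow_ofReal hne, arg_ofReal_mul_exp hμpos ⟨by linarith, hγπ.le⟩]
        rw [show e * (π / e) = π by field_simp, Real.sin_pi, mul_zero]
      · rw [hF, ← hμ0]; simp [zero_cpow hec]
  · -- positive imaginary part inside
    intro z hz hzim
    obtain ⟨hne, -⟩ := hin z hz hzim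
    obtain ⟨h1, h2⟩ := hsect z hz hzim
    rw [im_cpow_ofReal hne]
    refine mul_pos (Real.rpow_pos_of_pos (norm_pos_iff.2 hne) _) (Real.sin_pos_of_pos_of_lt_pi (mul_pos he0 h1) ?_)
    calc e * arg (F z) < e * (π / e) := mul_lt_mul_of_pos_left h2 he0
      _ = π := by field_simp
  · -- the derivative inside
    intro z hz hzim
    obtain ⟨hne, him⟩ := hin z hz hzim
    have hslit : F z ∈ slitPlane := mem_slitPlane_iff.2 (Or.inr him.ne')
    have hF : HasDerivAt F (deriv F z) z := (hd.differentiableAt (hopen.mem_nhds ⟨hz, hzim⟩)).hasDerivAt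
    exact ⟨hne, hF.cpow_const hslit⟩

/-- **Germ bounds for the power map of a sector map.** In the situation of `sectorPow_props`: on a smaller open
half-disc, `c‖ζ‖ ≤ ‖F ζ‖^e ≤ C‖ζ‖` and `c ≤ e ‖F ζ‖^{e-1} ‖F′ ζ‖ ≤ C` with `c > 0`. -/
theorem sectorPow_bounds (F : ℂ → ℂ) {r e : ℝ} (hr : 0 < r) (he : 1 < e)
    (hc : ContinuousOn F (ball (0:ℂ) r ∩ {z : ℂ | 0 ≤ z.im}))
    (hd : DifferentiableOn ℂ F (ball (0:ℂ) r ∩ {z : ℂ | 0 < z.im})) (h0 : F 0 = 0)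
    (hdiam : ∀ z ∈ ball (0:ℂ) r, z.im = 0 → ∃ μ : ℝ, 0 ≤ μ ∧ (F z = μ ∨ F z = μ * exp ((π / e : ℝ) * I)))
    (hsect : ∀ z ∈ ball (0:ℂ) r, 0 < z.im → 0 < arg (F z) ∧ arg (F z) < π / e) :
    ∃ c C r' : ℝ, 0 < c ∧ 0 < C ∧ 0 < r' ∧ r' ≤ r ∧ ∀ ζ ∈ ball (0:ℂ) r', 0 < ζ.im →
      F ζ ≠ 0 ∧ c * ‖ζ‖ ≤ ‖F ζ‖ ^ e ∧ ‖F ζ‖ ^ e ≤ C * ‖ζ‖ ∧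
      c ≤ e * ‖F ζ‖ ^ (e - 1) * ‖deriv F ζ‖ ∧ e * ‖F ζ‖ ^ (e - 1) * ‖deriv F ζ‖ ≤ C := by
  have he0 : 0 < e := by linarith
  obtain ⟨hfc, hfd, hfreal, hf0, hfpos, hfder⟩ := sectorPow_props F hr he hc hd h0 hdiam hsect
  obtain ⟨c, C, r', hcpos, hCpos, hr', hr'r, hb⟩ := germ_bounds (fun ζ => F ζ ^ (e : ℂ)) r hr hfc hfd hfreal hf0 hfpos
  refine ⟨c, C, r', hcpos, hCpos, hr', hr'r, fun ζ hζ hζim => ?_⟩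
  obtain ⟨b1, b2, b3, b4⟩ := hb ζ hζ hζim
  obtain ⟨hne, hder⟩ := hfder ζ (ball_subset_ball hr'r hζ) hζim
  have hn : ‖F ζ ^ (e : ℂ)‖ = ‖F ζ‖ ^ e := norm_cpow_real _ _
  have hn' : ‖deriv (fun ζ => F ζ ^ (e : ℂ)) ζ‖ = e * ‖F ζ‖ ^ (e - 1) * ‖deriv F ζ‖ := by
    rw [hder.deriv, norm_mul, norm_mul, show (e : ℂ) - 1 = ((e - 1 : ℝ) : ℂ) by push_cast; ring, norm_cpow_real,
      norm_real, Real.norm_eq_abs, abs_of_pos he0]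
  rw [hn] at b1 b2
  rw [hn'] at b3 b4
  exact ⟨hne, b1, b2, b3, b4⟩

/-! ## The three exponents of the local analysis -/

/-- **A right-angled corner of the domain** (registered helper): if `F` maps the half-disc onto a neighbourhood of the
vertex of the quarter-plane `{0 < arg < π/2}` as in `sectorPow_props` with `e = 2`, then `‖F′ ζ‖² ‖ζ‖` is bounded
above and below by positive constants on a smaller open half-disc (`F ≍ ζ^{1/2}`). -/
theorem corner_deriv_bounds : ∀ (F : ℂ → ℂ) (r : ℝ), 0 < r → ContinuousOn F (Metric.ball (0:ℂ) r ∩ {z : ℂ | 0 ≤ z.im}) → DifferentiableOn ℂ F (Metric.ball (0:ℂ) r ∩ {z : ℂ | 0 < z.im}) → F 0 = 0 → (∀ z ∈ Metric.ball (0:ℂ) r, z.im = 0 → ∃ μ : ℝ, 0 ≤ μ ∧ (F z = μ ∨ F z = μ * Complex.exp ((Real.pi / 2 : ℝ) * Complex.I))) → (∀ z ∈ Metric.ball (0:ℂ) r, 0 < z.im → 0 < Complex.arg (F z) ∧ Complex.arg (F z) < Real.pi / 2) → ∃ c C r' : ℝ, 0 < c ∧ 0 < C ∧ 0 < r' ∧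 r' ≤ r ∧ ∀ ζ ∈ Metric.ball (0:ℂ) r', 0 < ζ.im → c ≤ ‖deriv F ζ‖ ^ 2 * ‖ζ‖ ∧ ‖deriv F ζ‖ ^ 2 * ‖ζ‖ ≤ C := by
  intro F r hr hc hd h0 hdiam hsect
  obtain ⟨c, C, r', hcpos, hCpos, hr', hr'r, hb⟩ := sectorPow_bounds F (e := 2) hr (by norm_num) hc hd h0 hdiam hsect
  refine ⟨c ^ 2 / (4 * C), C ^ 2 / (4 * c), r', by positivity, by positivity, hr', hr'r, fun ζ hζ hζim => ?_⟩
  obtain ⟨hne, b1, b2, b3, b4⟩ := hb ζ hζ hζim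
  have hζ0 : 0 < ‖ζ‖ := norm_pos_iff.2 (by rintro rfl; simp at hζim)
  have hF0 : 0 < ‖F ζ‖ := norm_pos_iff.2 hne
  rw [show (2:ℝ) - 1 = 1 by norm_num, Real.rpow_one] at b3 b4
  rw [show (2:ℝ) = ((2:ℕ) : ℝ) by norm_num, Real.rpow_natCast] at b1 b2
  set x := ‖F ζ‖ with hx
  set y := ‖deriv F ζ‖ with hy
  set t := ‖ζ‖ with ht
  have hy0 : 0 ≤ y := norm_nonneg _
  -- `(2 x y)² t = 4 y² t · x²` with `c t ≤ x² ≤ C t` and `c ≤ 2 x y ≤ C`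
  have key : y ^ 2 * t = (2 * x * y) ^ 2 * t / (4 * x ^ 2) := by field_simp; ring
  constructor
  · rw [key, le_div_iff₀ (by positivity)]
    have h1 : c ^ 2 ≤ (2 * x * y) ^ 2 := by nlinarith
    have h2 : c ^ 2 * (4 * x ^ 2) ≤ c ^ 2 * (4 * (C * t)) := by nlinarith
    calc c ^ 2 / (4 * C) * (4 * x ^ 2) = c ^ 2 * (4 * x ^ 2) / (4 * C) := by ring
      _ ≤ c ^ 2 * (4 * (C * t)) / (4 * C) := by gcongr
      _ = c ^ 2 * t := by field_simp
      _ ≤ (2 * x * y) ^ 2 * t := by nlinarith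
  · rw [key, div_le_iff₀ (by positivity)]
    have h1 : (2 * x * y) ^ 2 ≤ C ^ 2 := by nlinarith
    calc (2 * x * y) ^ 2 * t ≤ C ^ 2 * t := by nlinarith
      _ = C ^ 2 / (4 * c) * (4 * (c * t)) := by field_simp
      _ ≤ C ^ 2 / (4 * c) * (4 * x ^ 2) := by gcongr

/-- **A marked corner of the hexagon** (`γ = π/3`, `F ≍ ζ^{1/3}`): `‖F′ ζ‖³ ‖ζ‖² ≤ C` on a smaller open half-disc. -/
theorem hex13_deriv_bound (F : ℂ → ℂ) {r : ℝ} (hr : 0 < r)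
    (hc : ContinuousOn F (ball (0:ℂ) r ∩ {z : ℂ | 0 ≤ z.im}))
    (hd : DifferentiableOn ℂ F (ball (0:ℂ) r ∩ {z : ℂ | 0 < z.im})) (h0 : F 0 = 0)
    (hdiam : ∀ z ∈ ball (0:ℂ) r, z.im = 0 → ∃ μ : ℝ, 0 ≤ μ ∧ (F z = μ ∨ F z = μ * exp ((π / 3 : ℝ) * I)))
    (hsect : ∀ z ∈ ball (0:ℂ) r, 0 < z.im → 0 < arg (F z) ∧ arg (F z) < π / 3) :
    ∃ C r' : ℝ, 0 < C ∧ 0 < r' ∧ r' ≤ r ∧ ∀ ζ ∈ ball (0:ℂ) r', 0 < ζ.im → ‖deriv F ζ‖ ^ 3 * ‖ζ‖ ^ 2 ≤ C := by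
  obtain ⟨c, C, r', hcpos, hCpos, hr', hr'r, hb⟩ := sectorPow_bounds F (e := 3) hr (by norm_num) hc hd h0 hdiam hsect
  refine ⟨C ^ 3 / (27 * c ^ 2), r', by positivity, hr', hr'r, fun ζ hζ hζim => ?_⟩
  obtain ⟨hne, b1, -, -, b4⟩ := hb ζ hζ hζim
  have hζ0 : 0 < ‖ζ‖ := norm_pos_iff.2 (by rintro rfl; simp at hζim)
  have hF0 : 0 < ‖F ζ‖ := norm_pos_iff.2 hne
  rw [show (3:ℝ) - 1 = ((2:ℕ) : ℝ) by norm_num, Real.rpow_natCast] at b4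
  rw [show (3:ℝ) = ((3:ℕ) : ℝ) by norm_num, Real.rpow_natCast] at b1
  set x := ‖F ζ‖ with hx
  set y := ‖deriv F ζ‖ with hy
  set t := ‖ζ‖ with ht
  have hy0 : 0 ≤ y := norm_nonneg _
  -- `(3 x² y)³ = 27 y³ (x³)²` with `x³ ≥ c t` and `3 x² y ≤ C`
  have h1 : (3 * x ^ 2 * y) ^ 3 ≤ C ^ 3 := pow_le_pow_left₀ (by positivity) b4 3
  have h2 : (c * t) ^ 2 ≤ (x ^ 3) ^ 2 := pow_le_pow_left₀ (by positivity) b1 2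
  rw [le_div_iff₀ (by positivity)]
  calc y ^ 3 * t ^ 2 * (27 * c ^ 2) = 27 * y ^ 3 * (c * t) ^ 2 := by ring
    _ ≤ 27 * y ^ 3 * (x ^ 3) ^ 2 := by gcongr
    _ = (3 * x ^ 2 * y) ^ 3 := by ring
    _ ≤ C ^ 3 := h1

/-- **An unmarked corner, or a mark on a side, of the hexagon** (`γ = 2π/3`, `F ≍ ζ^{2/3}`): `‖F′ ζ‖³ ‖ζ‖ ≤ C` on a
smaller open half-disc. -/
theorem hex23_deriv_bound (F : ℂ → ℂ) {r : ℝ} (hr : 0 < r)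
    (hc : ContinuousOn F (ball (0:ℂ) r ∩ {z : ℂ | 0 ≤ z.im}))
    (hd : DifferentiableOn ℂ F (ball (0:ℂ) r ∩ {z : ℂ | 0 < z.im})) (h0 : F 0 = 0)
    (hdiam : ∀ z ∈ ball (0:ℂ) r, z.im = 0 → ∃ μ : ℝ, 0 ≤ μ ∧ (F z = μ ∨ F z = μ * exp ((2 * π / 3 : ℝ) * I)))
    (hsect : ∀ z ∈ ball (0:ℂ) r, 0 < z.im → 0 < arg (F z) ∧ arg (F z) < 2 * π / 3) :
    ∃ C r' : ℝ, 0 < C ∧ 0 < r' ∧ r' ≤ r ∧ ∀ ζ ∈ ball (0:ℂ) r', 0 < ζ.im → ‖deriv F ζ‖ ^ 3 * ‖ζ‖ ≤ C := by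
  have h32 : π / (3 / 2 : ℝ) = 2 * π / 3 := by field_simp
  obtain ⟨c, C, r', hcpos, hCpos, hr', hr'r, hb⟩ := sectorPow_bounds F (e := 3 / 2) hr (by norm_num) hc hd h0
    (by rw [h32]; exact hdiam) (by rw [h32]; exact hsect)
  refine ⟨Real.sqrt (64 * C ^ 6 / (729 * c ^ 2)), r', by positivity, hr', hr'r, fun ζ hζ hζim => ?_⟩
  obtain ⟨hne, b1, -, -, b4⟩ := hb ζ hζ hζim
  have hζ0 : 0 < ‖ζ‖ := norm_pos_iff.2 (by rintro rfl; simp at hζim)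
  have hF0 : 0 < ‖F ζ‖ := norm_pos_iff.2 hne
  set x := ‖F ζ‖ with hx
  set y := ‖deriv F ζ‖ with hy
  set t := ‖ζ‖ with ht
  have hy0 : 0 ≤ y := norm_nonneg _
  -- `(x^{3/2})² = x³` and `(x^{1/2})² = x`
  have hp1 : (x ^ ((3:ℝ) / 2)) ^ 2 = x ^ 3 := by
    rw [← Real.rpow_natCast, ← Real.rpow_mul hF0.le]; norm_num
  have hp2 : (x ^ ((3:ℝ) / 2 - 1)) ^ 2 = x := by
    rw [← Real.rpow_natCast, ← Real.rpow_mul hF0.le]; norm_num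
  have hb1 : (c * t) ^ 2 ≤ x ^ 3 := by rw [← hp1]; exact pow_le_pow_left₀ (by positivity) b1 2
  have hb4 : (3 / 2 * x ^ ((3:ℝ) / 2 - 1) * y) ^ 2 ≤ C ^ 2 := pow_le_pow_left₀ (by positivity) b4 2
  have hb4' : 9 / 4 * x * y ^ 2 ≤ C ^ 2 := by
    have : (3 / 2 * x ^ ((3:ℝ) / 2 - 1) * y) ^ 2 = 9 / 4 * (x ^ ((3:ℝ) / 2 - 1)) ^ 2 * y ^ 2 := by ring
    rw [this, hp2] at hb4; exact hb4
  -- `(y³ t)² ≤ 64 C⁶ / (729 c²)`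
  have hsq : (y ^ 3 * t) ^ 2 ≤ 64 * C ^ 6 / (729 * c ^ 2) := by
    rw [le_div_iff₀ (by positivity)]
    have h3 : (9 / 4 * x * y ^ 2) ^ 3 ≤ (C ^ 2) ^ 3 := pow_le_pow_left₀ (by positivity) hb4' 3
    calc (y ^ 3 * t) ^ 2 * (729 * c ^ 2) = 64 * ((9 / 4 * x * y ^ 2) ^ 3 * (c * t) ^ 2) / x ^ 3 := by
          field_simp; ring
      _ ≤ 64 * ((C ^ 2) ^ 3 * x ^ 3) / x ^ 3 := by gcongr
      _ = 64 * C ^ 6 := by field_simp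
  exact (Real.le_sqrt (by positivity) (by positivity)).2 hsq

end Summit.CriticalPhenomena.CardyFormulaZ2.Cruxes.ParafermionToSLESixFamilies.PotentialDarbouxPicardDiamond

end
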